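import Mathlib
import Summits.Ventures.PercRepro2.Tail2DBlockCalc
import Summits.Ventures.PercRepro2.Tail2DHarrisSP
import Summits.Ventures.PercRepro2.Tail2DFlowOneBlocks
import Summits.Ventures.PercRepro2.Tail2DFlowOnePar
import Summits.Ventures.PercRepro2.Tail2DFlowOneParEdge
import Summits.Ventures.PercRepro2.Tail2DSDomSwap
import Summits.Ventures.PercRepro2.Tail2DFlowOneStep01
import Summits.Ventures.PercRepro2.Tail2DFlowOneThreeCounts
import Summits.Ventures.PercRepro2.Tail2DFlowOneThreeCerts
import Summits.Ventures.PercRepro2.Tail2DFlowOneThreeTwenty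
import Summits.Ventures.PercRepro2.Tail2DFlowOneThreeTwentyB

/-!
# (SD) at every clipped position on `(s ∥ t) ∥ r` for three flow-one networks
(seat mine-b, cell pub-perc-repro2; conjectures/MINE-B.md §43)

The assembly: the tile-to-tile certificates at `(3,0), (2,1), (1,2), (0,2), (3,−1)`
(`Tail2DFlowOneThreeCerts.lean`), the 21-move certificate at `(2,0)` (`Tail2DFlowOneThreeTwentyB.lean`), its
colour-swap dual `(1,1)` (`sdomZ_swap`), the one-factor step at `(0,1)` on `(s ∥ t) ∥ r` (`sdomZ_par_flowOne_01`
with (SD) and the anti-diagonal log-concavity of `s ∥ t` from `Tail2DFlowOnePar.lean` / `Tail2DFlowOneParEdge.lean`)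
and its dual `(2,−1)`, the Harris positions `u ≤ 1, v ≤ 0` (`sdomZ_of_le_one`), and the empty tails beyond the total
flow `3`.  Hence **`sdomZ_flowOne_par3`: (SD) at every clipped position on `(X ∥ Y) ∥ Z` for any three flow-one
(bridge-containing) SP networks with red crossings** — the second infinite family of parallel compositions without
single-edge factors on which (SD) is a theorem (after `sdomZ_flowOne_par`, two factors).  Corollaries: the
tail-average monotonicity (T-AVG) at every position and the count inequalities of the off-axis family on this class.
-/

namespace Summit.Ventures.PercRepro2.Tail2D

open V2Closure Finset

section Main

variable (s t r : V2Closure.SP)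

/-- **(SD) at every clipped position on the parallel composition of three flow-one networks** (each with a red
crossing) -/
theorem sdomZ_flowOne_par3 (hs : FlowOne s) (ht : FlowOne t) (hr : FlowOne r) (ha : 0 < (rSet s).card)
    (ha' : 0 < (rSet t).card) (ha'' : 0 < (rSet r).card) (u v : ℤ) :
    SDomZ (V2Closure.SP.par (V2Closure.SP.par s t) r) u v := by
  set Z := V2Closure.SP.par (V2Closure.SP.par s t) r with hZ
  have i30 : SDomZ Z 3 0 := by rw [sdomZ_iff_blockDom]; exact cert3_30 s t r hs ht hr ha ha' ha''
  have i21 : SDomZ Z 2 1 := by rw [sdomZ_iff_blockDom]; exact cert3_21 s t r hs ht hr ha ha' ha''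
  have i12 : SDomZ Z 1 2 := by rw [sdomZ_iff_blockDom]; exact cert3_12 s t r hs ht hr ha ha' ha''
  have i02 : SDomZ Z 0 2 := by rw [sdomZ_iff_blockDom]; exact cert3_02 s t r hs ht hr ha ha' ha''
  have i3m : SDomZ Z 3 (-1) := by rw [sdomZ_iff_blockDom]; exact cert3_3m s t r hs ht hr ha ha' ha''
  have i20 : SDomZ Z 2 0 := by rw [sdomZ_iff_blockDom]; exact cert3_20 s t r hs ht hr ha ha' ha''
  have i11 : SDomZ Z 1 1 := by
    have h := sdomZ_swap Z i20
    norm_num at h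
    exact h
  have i01 : SDomZ Z 0 1 := by
    have hY := sdomZ_flowOne_par s t hs ht ha ha' 0 1
    have hLC : tailCount (V2Closure.SP.par s t) 0 0 * tailCount (V2Closure.SP.par s t) 0 2
        ≤ tailCount (V2Closure.SP.par s t) 0 1 * tailCount (V2Closure.SP.par s t) 0 1 :=
      tailLC_flowOne_par s t hs ht 0 1
    have hT1 : 0 < tailCount (V2Closure.SP.par s t) 0 1 := by
      have := tailCount_par_10_pos s t ha
      rwa [tailCount_par_symm] at this
    exact sdomZ_par_flowOne_01 (V2Closure.SP.par s t) r hr ha'' hY hLC hT1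
  have i2m : SDomZ Z 2 (-1) := by
    have h := sdomZ_swap Z i01
    norm_num at h
    exact h
  have big := tailCount_par3_big s t r hs ht hr
  rcases (show (u ≤ 1 ∧ v ≤ 0) ∨ (u ≤ 0 ∧ 1 ≤ v) ∨ (u = 1 ∧ 1 ≤ v) ∨ u = 2 ∨ u = 3 ∨ 4 ≤ u by omega)
    with ⟨hu, hv⟩ | ⟨hu, hv⟩ | ⟨hu, hv⟩ | hu | hu | hu
  · exact sdomZ_of_le_one Z u v hu hv
  · rcases (show v = 1 ∨ v = 2 ∨ 3 ≤ v by omega) with hv | hv | hv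
    · exact sdomZ_clip_congr _ (u' := 0) (v' := 1) (by omega) (by omega) (by omega) (by omega) i01
    · exact sdomZ_clip_congr _ (u' := 0) (v' := 2) (by omega) (by omega) (by omega) (by omega) i02
    · exact sdomZ_of_empty_tail _ u v (Or.inr (big _ _ (by omega)))
  · rcases (show v = 1 ∨ v = 2 ∨ 3 ≤ v by omega) with hv | hv | hv
    · exact sdomZ_clip_congr _ (u' := 1) (v' := 1) (by omega) (by omega) (by omega) (by omega) i11
    · exact sdomZ_clip_congr _ (u' := 1) (v' := 2) (by omega) (by omega) (by omega) (by omega) i12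
    · exact sdomZ_of_empty_tail _ u v (Or.inl (big _ _ (by omega)))
  · rcases (show v ≤ -1 ∨ v = 0 ∨ v = 1 ∨ 2 ≤ v by omega) with hv | hv | hv | hv
    · exact sdomZ_clip_congr _ (u' := 2) (v' := -1) (by omega) (by omega) (by omega) (by omega) i2m
    · exact sdomZ_clip_congr _ (u' := 2) (v' := 0) (by omega) (by omega) (by omega) (by omega) i20
    · exact sdomZ_clip_congr _ (u' := 2) (v' := 1) (by omega) (by omega) (by omega) (by omega) i21
    · exact sdomZ_of_empty_tail _ u v (Or.inl (big _ _ (by omega)))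
  · rcases (show v ≤ -1 ∨ v = 0 ∨ 1 ≤ v by omega) with hv | hv | hv
    · exact sdomZ_clip_congr _ (u' := 3) (v' := -1) (by omega) (by omega) (by omega) (by omega) i3m
    · exact sdomZ_clip_congr _ (u' := 3) (v' := 0) (by omega) (by omega) (by omega) (by omega) i30
    · exact sdomZ_of_empty_tail _ u v (Or.inl (big _ _ (by omega)))
  · exact sdomZ_of_empty_tail _ u v (Or.inl (big _ _ (by omega)))

/-- the tail-average monotonicity (T-AVG) at every position on `(s ∥ t) ∥ r` for flow-one factors -/
theorem tailAvg_flowOne_par3 (hs : FlowOne s) (ht : FlowOne t) (hr : FlowOne r) (ha : 0 < (rSet s).card)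
    (ha' : 0 < (rSet t).card) (ha'' : 0 < (rSet r).card) (a c : ℕ) :
    TailAvg (V2Closure.SP.par (V2Closure.SP.par s t) r) a c :=
  tailAvg_of_sdomZ _ a c (sdomZ_flowOne_par3 s t r hs ht hr ha ha' ha'' a c)

/-- (SD) in `ℕ`-form on `(s ∥ t) ∥ r`: for every monotone weight `f` and every `a, c`,
`Σ_f(a,c) · T(a−1,c+1) ≤ Σ_f(a−1,c+1) · T(a,c)` -/
theorem sdom_flowOne_par3 (hs : FlowOne s) (ht : FlowOne t) (hr : FlowOne r) (ha : 0 < (rSet s).card)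
    (ha' : 0 < (rSet t).card) (ha'' : 0 < (rSet r).card) (a c : ℕ)
    (f : (V2Closure.SP.par (V2Closure.SP.par s t) r).Conf → ℕ) (hf : Monotone f) :
    tailSum (V2Closure.SP.par (V2Closure.SP.par s t) r) f a c
        * tailCount (V2Closure.SP.par (V2Closure.SP.par s t) r) (a - 1) (c + 1)
      ≤ tailSum (V2Closure.SP.par (V2Closure.SP.par s t) r) f (a - 1) (c + 1)
        * tailCount (V2Closure.SP.par (V2Closure.SP.par s t) r) a c := by
  have key := sdomZ_flowOne_par3 s t r hs ht hr ha ha' ha'' a c f hf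
  have e1 : ((a : ℤ)).toNat = a := by omega
  have e2 : ((a : ℤ) - 1).toNat = a - 1 := by omega
  have e3 : ((c : ℤ)).toNat = c := by omega
  have e4 : ((c : ℤ) + 1).toNat = c + 1 := by omega
  rw [e1, e2, e3, e4] at key
  exact key

end Main

end Summit.Ventures.PercRepro2.Tail2D
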